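/-
Copyright (c) 2026 the pub-hodgecm-mathlib formalisation cell (harness21).  Prover seat hodgecm-mathlib-K2E3-p37 (g0), Track B «K2-LIT» ∕ h413 =
`stmt-HodgeConjecture-24833`, line `K2_E3_EllipticInputs`, unit U4 «Keys», PART «U4Keys» socket :182 (U4f-χ₁-ram-one-pos)
`sig_K2E3KeysThmTwoContractingRamifiedCharOnePosDepth` (LINE-LEAD K2E3-plan (g4) L4∕E3 EMIT #5 deal D163 2026-09-04T15:31:56Z; R0 census + addenda
`K2/K2E3-p37/g0/CENSUS-U4f-PosDepth.K2E3-p37-g0.md`): programme A_pos brick (v)-CM «THE LEVEL-`n` IWAHORI DATUM ON `U(Φ₃)(L⁺_v)`» — in the (G3)-frame of ★ `K2E3BranchATypeLettersCM`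
an Iwahori datum of `cmBorelTriple L 3 v` with FIRST level `J_n = eA⁻¹(K₀ ⊓ g_nK₀g_n⁻¹)`, second level `I`, and `N̄ = eA⁻¹(w N_w w)`.  REPORT-FIRST 2026-09-04.
-/
import Summits.HodgeConjecture.HodgeConjecture.Theorems.K2E3BranchATypeLettersCM        -- ★ Z2A-3c (iii) (K2E3-p06 (g4)): the (G3) frame, `exists_iwahoriDatum_K_zero_eq_Nbar_eq` (the depth-zero datum, our template);
                                                                                           --   brings ★ `K2E3IwahoriDetection.eA_mem_torusU_iff ∕ eA_mem_unipotentU_iff`, ★ `K2E3IwahoriLevelDatumPF`, ★ `StructureTransport`, ★ BigCell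
import Summits.HodgeConjecture.HodgeConjecture.Theorems.K2E3IwahoriLevelNFactorisation   -- ★ p861548 (this seat): `J_n` test `mem_glInt_inf_conj_glInt_pow_iff`, factorisation `coe_inf_pow_eq_mul`
import Summits.HodgeConjecture.HodgeConjecture.Theorems.K2E3IwahoriDatumPrepend          -- ★ p861764 (this seat): `exists_iwahoriDatum_prepend`
import HarnessLib

/-!
# K2 ∕ E3 «EllipticInputs», unit U4 «Keys» — (U4f-χ₁-ram-one-pos), programme A_pos brick (v)-CM: AN IWAHORI DATUM FOR `cmBorelTriple L 3 v` WHOSE FIRST LEVEL IS THE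
# LEVEL-`n` IWAHORI `J_n` (second level `I`, `N̄ = eA⁻¹(w N_w w)`, same ray)   [Casselman1995 Prop. 1.4.4; BruhatTits1972 (4.4.3)–(4.4.4); Roche1998 §2–§3]

Cell hodgecm-mathlib, Track B «K2-LIT», crux item H413 = stmt-HodgeConjecture-24833 (route `HCCMUnconditional`, no route verbs); target BY NAME the OPEN tier-0 leaf
`…K2E3EllipticInputs.U4Keys.sig_K2E3KeysThmTwoContractingRamifiedCharOnePosDepth` (U4Keys ED. 8 :182), design D-I «vanishing functional» at POSITIVE depth.  Author K2E3-p37 (g0).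
`--supports stmt-HodgeConjecture-24833 --as helper`; THEOREMS ONLY (no `def` ∕ `instance` ∕ `notation` ∕ named fact ∕ `sorry`).  Frame = the (G3)-EXPLICIT frame of ★
`K2E3BranchATypeLettersCM` (`L v w hw eA heA ϖ hϖ g₁ hg₁ K0 K1 I hK0 hK1 hI`) plus the level-`n` letters `gn hgn Jn hJn` (`Jn = K0 ⊓ eA⁻¹(g_nK₀g_n⁻¹ ∩ U_w)`).  NOT THE PAYER of :182.

THE POINT.  The depth-zero Branch-A assembly (★ `K2E3BranchAIrreducibleDepthZero`) consumes an Iwahori datum `𝓘` of `cmBorelTriple L 3 v` with `𝓘.K 0 = I` and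
`𝓘.N̄ = eA⁻¹(N_w.map (conj w))` (★ `K2E3BranchATypeLettersCM.exists_iwahoriDatum_K_zero_eq_Nbar_eq`) through ★ Z2A-2 (dilation: `𝓘.K m ∩ N̄` fixes a dilate) and ★ V2b
(the `(𝓘.K 0, θ)`-type vector from `𝓘.factorization 0`).  At positive depth the type vector lives on the level-`n` Iwahori `J_n` (★ p861548), so the assembly wants the SAME
datum with `J_n` PREPENDED: §1 shows `J_n ≤ I` in the model (`|x| ≤ |ϖ|ⁿ ⟹ |x| < 1`, the two tests ★ `mem_glInt_inf_conj_glInt_pow_iff` ∕ ★ `mem_glInt_inf_conj_glInt_iff`); §2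
builds the model datum at level `I` (★ `K2E3IwahoriLevelDatumPF.exists_iwahoriDatum_iwahoriLevel`, ray `d(ϖ, 1, (σϖ)⁻¹)` as in the template), PREPENDS the compact open `J_n`
(★ `UnitaryLatticeTree.isOpen∕isCompact_glInt_inf_conj_glInt_subgroupOf`; factorisation ★ p861548 `coe_inf_pow_eq_mul` relative to the datum's `N̄ = w N_w w`) by ★ p861764
`exists_iwahoriDatum_prepend`, and pulls the result back to `Gqs L v` along `eA` by ★ `StructureTransport.exists_iwahoriDatum_comap` (Levi and radical correspond: ★
`K2E3IwahoriDetection.eA_mem_torusU_iff` ∕ `eA_mem_unipotentU_iff`).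
* §1 (model) `inf_pow_le_inf` (`J_n ≤ I` for `1 ≤ n`).
* §2 (CM, (G3) frame) **`exists_iwahoriDatum_K_zero_eq_levelN`** — `∃ 𝓘 : (cmBorelTriple L 3 v).IwahoriDatum, 𝓘.K 0 = Jn ∧ 𝓘.K 1 = I ∧ 𝓘.Nbar = (N_w.map (conj w)).comap eA`.
HONEST LABEL: HC_CM is proved only modulo the 7 printed citations (2 remaining named inputs: hLiu418 = stmt-HodgeConjecture-24832, h413 = stmt-HodgeConjecture-24833)
until rung 0 closes; count-neutral — this file does NOT pay the leaf; no printed citation is discharged.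

## References
* [Casselman1995] W. Casselman, *Introduction to the theory of admissible representations of `p`-adic reductive groups* (1995), Prop. 1.4.4, Thm. 3.3.3.
* [BruhatTits1972] F. Bruhat, J. Tits, *Groupes réductifs sur un corps local I*, Publ. Math. IHÉS 41 (1972), (4.4.3)–(4.4.4).
* [Roche1998] A. Roche, *Types and Hecke algebras for principal series representations of split reductive p-adic groups*, Ann. Sci. ÉNS (4) 31 (1998), §2–§3.
* [PlatonovRapinchuk1994] V. Platonov, A. Rapinchuk, *Algebraic Groups and Number Theory* (1994), §5.1 (the one-place model at a non-split place).
-/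

set_option autoImplicit false
-- the mandated namespace has the single-problem summit's repeated segment (`HodgeConjecture.HodgeConjecture`)
set_option linter.dupNamespace false

noncomputable section

open NumberField IsDedekindDomain MeasureTheory ValuativeRel
open scoped Matrix MatrixGroups WithZero Valued Pointwise
open Literature.NumberTheory Literature.NumberTheory.Automorphic Literature.NumberTheory.Automorphic.UnitaryGroup
open Literature.NumberTheory.Rogawski1990

namespace Summit.HodgeConjecture.HodgeConjecture.Cruxes.H413.K2E3IwahoriLevelNLettersCM

open Summit.HodgeConjecture.HodgeConjecture.Cruxes.H413

/-! ## §1 Model: `J_n ≤ I` -/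

section Model

variable {K : Type*} [Field K] [Valued K ℤᵐ⁰] [ValuativeRel K] [(Valued.v : Valuation K ℤᵐ⁰).Compatible]
  (σ : K →+* K) {ϖ : K} {J : Matrix (Fin 3) (Fin 3) K} (hJ : J = (StdForm.antidiagonal 3).over K)
  (hvσ : ∀ a, Valued.v (σ a) = Valued.v a) (hvϖ : Valued.v ϖ = WithZero.exp (-1 : ℤ))
  (g₁ : GL (Fin 3) K) (hg₁ : (g₁ : Matrix (Fin 3) (Fin 3) K) = Matrix.diagonal ![(1 : K), 1, ϖ])
  {n : ℕ} (gn : GL (Fin 3) K) (hgn : (gn : Matrix (Fin 3) (Fin 3) K) = Matrix.diagonal ![(1 : K), 1, ϖ ^ n])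

include hJ hvσ hvϖ hg₁ hgn in
/-- **`J_n ≤ I` for `1 ≤ n`**: an integral unitary with strictly-lower entries of valuation `≤ |ϖ|ⁿ < 1` passes the Iwahori test (★ `mem_glInt_inf_conj_glInt_pow_iff`, ★
`mem_glInt_inf_conj_glInt_iff`). [cite: BruhatTits1972, (4.4.3)–(4.4.4)] [cite: Roche1998, §2–§3] -/
theorem inf_pow_le_inf (hn : 1 ≤ n) :
    (glInt 3 K).subgroupOf (unitaryGroupOfForm σ J) ⊓ ((glInt 3 K).map (MulAut.conj gn).toMonoidHom).subgroupOf (unitaryGroupOfForm σ J) ≤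
      (glInt 3 K).subgroupOf (unitaryGroupOfForm σ J) ⊓ ((glInt 3 K).map (MulAut.conj g₁).toMonoidHom).subgroupOf (unitaryGroupOfForm σ J) := by
  have hvϖ1 : Valued.v ϖ < 1 := by rw [hvϖ, ← WithZero.exp_zero, WithZero.exp_lt_exp]; norm_num
  have hvϖn : Valued.v ϖ ^ n < 1 := pow_lt_one' hvϖ1 (Nat.one_le_iff_ne_zero.1 hn)
  intro k hk
  obtain ⟨hint, h20, h21, h10⟩ := (K2E3IwahoriLevelNFactorisation.mem_glInt_inf_conj_glInt_pow_iff σ hJ hvσ hvϖ gn hgn k).1 hk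
  exact (mem_glInt_inf_conj_glInt_iff σ hJ hvσ hvϖ g₁ hg₁ k).2 ⟨hint, h20.trans_lt hvϖn, h21.trans_lt hvϖn, h10.trans_lt hvϖn⟩

end Model

/-! ## §2 CM: an Iwahori datum with `K 0 = J_n`, `K 1 = I`, `N̄ = eA⁻¹(w N_w w)` -/

section CM

variable (L : Type) [Field L] [NumberField L] [IsCMField L] (v : HeightOneSpectrum (𝓞 ↥(maximalRealSubfield L)))
  (w : PlacesOver L v) (hw : IsCMField.complexConj L • w.1 = w.1)
  (eA : Gqs L v ≃ₜ* ↥(unitaryGroupOfForm (galAdicCompletionMap (L := L) (IsCMField.complexConj L) hw) ((StdForm.antidiagonal 3).over (w.1.adicCompletion L))))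
  (heA : ∀ g : Gqs L v,
    ((eA g : ↥(unitaryGroupOfForm (galAdicCompletionMap (L := L) (IsCMField.complexConj L) hw) ((StdForm.antidiagonal 3).over (w.1.adicCompletion L)))) :
        GL (Fin 3) (w.1.adicCompletion L)) =
      ((localNonsplitEquiv (IsCMField.complexConj L) (qsForm L) (IsCMField.complexConj_ne_one L) w hw g :
        ↥(unitaryGroupOfForm (galAdicCompletionMap (L := L) (IsCMField.complexConj L) hw) (placeForm (qsForm L) w.1))) : GL (Fin 3) (w.1.adicCompletion L)))
  {ϖ : w.1.adicCompletion L} (hϖ : Valued.v ϖ = WithZero.exp (-1 : ℤ))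
  (g₁ : GL (Fin 3) (w.1.adicCompletion L)) (hg₁ : (g₁ : Matrix (Fin 3) (Fin 3) (w.1.adicCompletion L)) = Matrix.diagonal ![(1 : w.1.adicCompletion L), 1, ϖ])
  (K0 K1 I : Subgroup (Gqs L v))
  (hK0 : K0 = ((glInt 3 (w.1.adicCompletion L)).subgroupOf
    (unitaryGroupOfForm (galAdicCompletionMap (L := L) (IsCMField.complexConj L) hw) ((StdForm.antidiagonal 3).over (w.1.adicCompletion L)))).comap
      eA.toMulEquiv.toMonoidHom)
  (hK1 : K1 = (((glInt 3 (w.1.adicCompletion L)).map (MulAut.conj g₁).toMonoidHom).subgroupOf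
    (unitaryGroupOfForm (galAdicCompletionMap (L := L) (IsCMField.complexConj L) hw) ((StdForm.antidiagonal 3).over (w.1.adicCompletion L)))).comap
      eA.toMulEquiv.toMonoidHom)
  (hI : I = K0 ⊓ K1)
  {n : ℕ} (gn : GL (Fin 3) (w.1.adicCompletion L))
  (hgn : (gn : Matrix (Fin 3) (Fin 3) (w.1.adicCompletion L)) = Matrix.diagonal ![(1 : w.1.adicCompletion L), 1, ϖ ^ n])
  (Jn : Subgroup (Gqs L v))
  (hJn : Jn = K0 ⊓ (((glInt 3 (w.1.adicCompletion L)).map (MulAut.conj gn).toMonoidHom).subgroupOf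
    (unitaryGroupOfForm (galAdicCompletionMap (L := L) (IsCMField.complexConj L) hw) ((StdForm.antidiagonal 3).over (w.1.adicCompletion L)))).comap
      eA.toMulEquiv.toMonoidHom)

include heA hϖ hg₁ hK0 hK1 hI hgn hJn in
set_option maxHeartbeats 1600000 in
-- the ray data, the prepended level and the transport clauses (class of the template ★ `K2E3BranchATypeLettersCM.exists_iwahoriDatum_K_zero_eq_Nbar_eq`)
/-- **THE LEVEL-`n` IWAHORI DATUM ON `U(Φ₃)(L⁺_v)`** (`1 ≤ n`): an Iwahori datum `𝓘` for `cmBorelTriple L 3 v` with `𝓘.K 0 = J_n` (`= K0 ⊓ eA⁻¹(g_nK₀g_n⁻¹ ∩ U_w)`, letter `hJn`),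
`𝓘.K 1 = I` AND `𝓘.N̄ = eA⁻¹(N_w.map (conj w))` — the model datum at level `I` (★ `K2E3IwahoriLevelDatumPF.exists_iwahoriDatum_iwahoriLevel`, ray `d(ϖ, 1, (σϖ)⁻¹)`) with the
compact open `J_n` PREPENDED (★ `exists_iwahoriDatum_prepend`; `J_n ≤ I` §1; factorisation ★ `coe_inf_pow_eq_mul`), pulled back along `eA` (★ `StructureTransport.exists_iwahoriDatum_comap`).
This is the datum the positive-depth Branch-A assembly feeds to ★ Z2A-2 and ★ V2b in place of the template's. [cite: Casselman1995, Prop. 1.4.4, Thm. 3.3.3] [cite: BruhatTits1972, (4.4.4)]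
[cite: Roche1998, §2–§3] [cite: PlatonovRapinchuk1994, §5.1] -/
theorem exists_iwahoriDatum_K_zero_eq_levelN (hn : 1 ≤ n) :
    ∃ 𝓘 : (cmBorelTriple L 3 v).IwahoriDatum, 𝓘.K 0 = Jn ∧ 𝓘.K 1 = I ∧
      𝓘.Nbar = (((borelTriple (galAdicCompletionMap (L := L) (IsCMField.complexConj L) hw) ((StdForm.antidiagonal 3).over (w.1.adicCompletion L)) rfl).N).map
        (MulAut.conj (weylLongU (galAdicCompletionMap (L := L) (IsCMField.complexConj L) hw)
          (rfl : (StdForm.antidiagonal 3).over (w.1.adicCompletion L) = _))).toMonoidHom).comap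
        (eA : Gqs L v →* ↥(unitaryGroupOfForm (galAdicCompletionMap (L := L) (IsCMField.complexConj L) hw) ((StdForm.antidiagonal 3).over (w.1.adicCompletion L)))) := by
  haveI : CompactSpace (Valued.integer (w.1.adicCompletion L)) := compactSpace_integer_adicCompletion L w.1
  have hσσ := (galAdicCompletionMap_galAdicCompletionMap_of_smul_eq (IsCMField.complexConj L) w (IsCMField.complexConj_ne_one L) hw)
  have hσc : Continuous (galAdicCompletionMap (L := L) (IsCMField.complexConj L) hw) := continuous_galAdicCompletionMap (L := L) (IsCMField.complexConj L) hw
  have hvσ : ∀ a, Valued.v (galAdicCompletionMap (L := L) (IsCMField.complexConj L) hw a) = Valued.v a :=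
    fun a => valued_galAdicCompletionMap (L := L) (IsCMField.complexConj L) hw a
  have hϖ0 : ϖ ≠ 0 := CartanUnique.uniformizer_ne_zero hϖ
  have hσϖ0 : galAdicCompletionMap (L := L) (IsCMField.complexConj L) hw ϖ ≠ 0 := (map_ne_zero _).2 hϖ0
  -- the ray `s = d(ϖ, 1, (σϖ)⁻¹)` and its ratio data (as in the template)
  obtain ⟨s, -, hs⟩ := exists_coe_eq_diag (galAdicCompletionMap (L := L) (IsCMField.complexConj L) hw)
    (rfl : (StdForm.antidiagonal 3).over (w.1.adicCompletion L) = _) hσσ hϖ0 (β := 1) (by rw [map_one, mul_one])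
  have hvσϖ : valuation (w.1.adicCompletion L) (galAdicCompletionMap (L := L) (IsCMField.complexConj L) hw ϖ) = valuation (w.1.adicCompletion L) ϖ :=
    (v_eq_iff_valuation_eq _ _).1 (hvσ ϖ)
  have hq0 : valuation (w.1.adicCompletion L) ϖ ≠ 0 := (Valuation.ne_zero_iff _).2 hϖ0
  have hq1 : valuation (w.1.adicCompletion L) ϖ < 1 := by
    rw [← v_lt_one_iff_valuation_lt_one, hϖ, ← WithZero.exp_zero, WithZero.exp_lt_exp]; norm_num
  set u : Fin 3 → (w.1.adicCompletion L)ˣ := ![Units.mk0 ϖ hϖ0, 1, (Units.mk0 _ hσϖ0)⁻¹] with hu_def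
  have hu0 : ((u 0 : (w.1.adicCompletion L)ˣ) : w.1.adicCompletion L) = ϖ := by simp only [hu_def, Matrix.cons_val_zero, Units.val_mk0]
  have hu1 : ((u 1 : (w.1.adicCompletion L)ˣ) : w.1.adicCompletion L) = 1 := by simp only [hu_def, Matrix.cons_val_one, Matrix.cons_val_zero, Units.val_one]
  have hu2 : ((u 2 : (w.1.adicCompletion L)ˣ) : w.1.adicCompletion L) = (galAdicCompletionMap (L := L) (IsCMField.complexConj L) hw ϖ)⁻¹ := by
    simp only [hu_def, Matrix.cons_val_two, Matrix.tail_cons, Matrix.head_cons, Units.val_inv_eq_inv_val, Units.val_mk0]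
  have hsu : ((s : ↥(unitaryGroupOfForm (galAdicCompletionMap (L := L) (IsCMField.complexConj L) hw) ((StdForm.antidiagonal 3).over (w.1.adicCompletion L)))) :
      GL (Fin 3) (w.1.adicCompletion L)) = glDiagonal 3 (w.1.adicCompletion L) u := by
    refine Units.ext ?_
    rw [hs, coe_glDiagonal]
    ext i j
    fin_cases i <;> fin_cases j <;> simp [hu0, hu1, hu2, Matrix.diagonal]
  have hu : ∀ i j : Fin 3, i < j → valuation (w.1.adicCompletion L) ((u i : w.1.adicCompletion L) * ((u j : w.1.adicCompletion L))⁻¹) ≤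
      valuation (w.1.adicCompletion L) ϖ := by
    intro i j hij
    fin_cases i <;> fin_cases j
    all_goals first | exact absurd hij (by decide) | skip
    · show valuation _ (((u 0 : (w.1.adicCompletion L)ˣ) : w.1.adicCompletion L) * (((u 1 : (w.1.adicCompletion L)ˣ) : w.1.adicCompletion L))⁻¹) ≤ _
      rw [hu0, hu1, inv_one, mul_one]
    · show valuation _ (((u 0 : (w.1.adicCompletion L)ˣ) : w.1.adicCompletion L) * (((u 2 : (w.1.adicCompletion L)ˣ) : w.1.adicCompletion L))⁻¹) ≤ _
      rw [hu0, hu2, inv_inv, map_mul, hvσϖ]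
      calc valuation _ ϖ * valuation _ ϖ ≤ valuation _ ϖ * 1 := mul_le_mul' le_rfl hq1.le
        _ = valuation _ ϖ := mul_one _
    · show valuation _ (((u 1 : (w.1.adicCompletion L)ˣ) : w.1.adicCompletion L) * (((u 2 : (w.1.adicCompletion L)ˣ) : w.1.adicCompletion L))⁻¹) ≤ _
      rw [hu1, hu2, inv_inv, one_mul, hvσϖ]
  -- the model datum at level `I`, with its `N̄` clause
  obtain ⟨𝓘', -, hNbar', hK0', -⟩ := K2E3IwahoriLevelDatumPF.exists_iwahoriDatum_iwahoriLevel L v w hw hϖ g₁ hg₁ hq0 hq1 s u hsu hu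
  -- PREPEND the compact open `J_n` (model)
  have hJo := UnitaryLatticeTree.isOpen_glInt_inf_conj_glInt_subgroupOf (galAdicCompletionMap (L := L) (IsCMField.complexConj L) hw)
    ((StdForm.antidiagonal 3).over (w.1.adicCompletion L)) gn
  have hJc := UnitaryLatticeTree.isCompact_glInt_inf_conj_glInt_subgroupOf (galAdicCompletionMap (L := L) (IsCMField.complexConj L) hw)
    ((StdForm.antidiagonal 3).over (w.1.adicCompletion L)) gn hσc
  have hle : (glInt 3 (w.1.adicCompletion L)).subgroupOf (unitaryGroupOfForm (galAdicCompletionMap (L := L) (IsCMField.complexConj L) hw) ((StdForm.antidiagonal 3).over (w.1.adicCompletion L))) ⊓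
        ((glInt 3 (w.1.adicCompletion L)).map (MulAut.conj gn).toMonoidHom).subgroupOf
          (unitaryGroupOfForm (galAdicCompletionMap (L := L) (IsCMField.complexConj L) hw) ((StdForm.antidiagonal 3).over (w.1.adicCompletion L))) ≤ 𝓘'.K 0 := by
    rw [hK0']
    exact inf_pow_le_inf (galAdicCompletionMap (L := L) (IsCMField.complexConj L) hw) rfl hvσ hϖ g₁ hg₁ gn hgn hn
  have hfac := K2E3IwahoriLevelNFactorisation.coe_inf_pow_eq_mul (galAdicCompletionMap (L := L) (IsCMField.complexConj L) hw)
    (rfl : (StdForm.antidiagonal 3).over (w.1.adicCompletion L) = _) hσσ hvσ hϖ gn hgn hn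
  rw [← hNbar'] at hfac
  obtain ⟨𝓘'', hK0'', hNbar'', -, hKsucc''⟩ := K2E3IwahoriDatumPrepend.exists_iwahoriDatum_prepend _ 𝓘' _ hJo hJc hle hfac
  -- the transport clauses
  have hM : ((borelTriple (galAdicCompletionMap (L := L) (IsCMField.complexConj L) hw) ((StdForm.antidiagonal 3).over (w.1.adicCompletion L)) rfl).M).comap
      (eA : Gqs L v →* ↥(unitaryGroupOfForm (galAdicCompletionMap (L := L) (IsCMField.complexConj L) hw) ((StdForm.antidiagonal 3).over (w.1.adicCompletion L)))) =
      (cmBorelTriple L 3 v).M := by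
    ext g
    rw [Subgroup.mem_comap, borelTriple_M]
    exact K2E3IwahoriDetection.eA_mem_torusU_iff L v w hw eA heA g
  have hN : ((borelTriple (galAdicCompletionMap (L := L) (IsCMField.complexConj L) hw) ((StdForm.antidiagonal 3).over (w.1.adicCompletion L)) rfl).N).comap
      (eA : Gqs L v →* ↥(unitaryGroupOfForm (galAdicCompletionMap (L := L) (IsCMField.complexConj L) hw) ((StdForm.antidiagonal 3).over (w.1.adicCompletion L)))) =
      (cmBorelTriple L 3 v).N := by
    ext g
    rw [Subgroup.mem_comap, borelTriple_N]
    exact K2E3IwahoriDetection.eA_mem_unipotentU_iff L v w hw eA heA g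
  obtain ⟨𝓘, hNbar, -, hK⟩ := StructureTransport.exists_iwahoriDatum_comap eA (cmBorelTriple L 3 v)
    (borelTriple (galAdicCompletionMap (L := L) (IsCMField.complexConj L) hw) ((StdForm.antidiagonal 3).over (w.1.adicCompletion L)) rfl) hM hN 𝓘''
  refine ⟨𝓘, ?_, ?_, ?_⟩
  · rw [hK 0, hK0'', hJn, hK0, ← Subgroup.comap_inf]
    rfl
  · rw [hK 1, hKsucc'' 0, hK0', hI, hK0, hK1, ← Subgroup.comap_inf]
    rfl
  · rw [hNbar, hNbar'', hNbar']

end CM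

end Summit.HodgeConjecture.HodgeConjecture.Cruxes.H413.K2E3IwahoriLevelNLettersCM

end
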